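import Summits.BirchSwinnertonDyer.BirchSwinnertonDyer.Theorems.EisensteinPrimesWeakLeopoldtAbove
import Literature.NumberTheory.IwasawaTheory.Greenberg2006.CohomologyCofiniteGenerationLeTwoOfTateTC
import HarnessLib

/-!
# T28b re-typing (`OfTateTC`: Tate's formula by name AT TOTALLY COMPLEX FIELDS) of `EisensteinPrimesWeakLeopoldtAbove.lean`

Route `EisensteinPrimes` (rung K5), crux 2 `GoodLatticeBDPValue` (stmt-BirchSwinnertonDyer-19032), line `halves`;
cell `bsd-eis`, seat `bsd-line-x1-p1` LEAD g8, lane «T28 / TATE RE-PLUMB» (helper, `--supports`).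

This file re-types, token for token, the theorems of `EisensteinPrimesWeakLeopoldtAbove` that carry
Greenberg 2006 Prop. 3.2 BY NAME (`h32 : (∀ (L : Type) [Field L] [NumberField L] [IsTotallyComplex L], Literature.NumberTheory.GaloisCohomology.tateGlobalEulerPoincareCharacteristic L)`, cofinite generation of
`Hⁱ(K_Σ/K, 𝒟)` / `Hⁱ(K_v, 𝒟)` for EVERY `i`, every number field, every prime) with that hypothesis replaced by
Tate's global Euler–Poincaré characteristic BY NAME AT TOTALLY COMPLEX FIELDS
(`h32 : ∀ L [IsTotallyComplex L], GaloisCohomology.tateGlobalEulerPoincareCharacteristic L`, Milne ADT I Thm. 5.1 — the shape the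
tree's class-formation road to Tate's theorem delivers; where a theorem's field was not syntactically totally complex an
`[IsTotallyComplex K]` binder is added and supplied by its callers from `IsImaginaryQuadratic K` / `∀ w, w.IsComplex`): on this line
Prop. 3.2 is read in degrees `i ≤ 2` only (global clause; the local clause is the unconditional
`Greenberg2006.prop32_local_holds`), and in those degrees it follows from Tate's formula alone
(`Greenberg2006.prop32_global_le_two_of_tate_tc`, file `CohomologyCofiniteGenerationLeTwoOfTateTC`: `H⁰`/`H¹` of
`G_{K,S}` with finite coefficients are finite unconditionally, `H²` by Tate, and Greenberg's dévissage for `Hⁿ`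
involves `Hⁿ`, `Hⁿ⁻¹` only).  Statements are otherwise VERBATIM (same binder order, new names `<name>_ofTateTC`; supersedes this seat's `…OfTate` twin, which took Tate's formula at every number field);
proofs are the tree proofs with the two reading lemmas substituted and the re-typed callees called.
EFFECT for the crux: Harari Thm. 17.13 (a) (`poitouTate_restricted_three_le`) is no longer consumed through
Prop. 3.2 at every number field, only at totally complex fields (Greenberg 2006 Prop. 4.1 is typed totally
imaginary; `cd_p ≤ 2` and the `H²` bookkeeping at the imaginary quadratic `K`), which is what the tree's
class-formation road (`RestrictedRamificationCdTwoOfH3Mu`, lane PT3-TC) proves.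

Theorems only; no definition, no named fact, no `sorry`, no instance. HONEST FRAMING: conditional on the PUBLISHED
named facts carried as hypotheses; closes nothing by itself; no summit statement / BSD / the crux is proved here.

## References
* R. Greenberg, *On the structure of certain Galois cohomology groups*, Doc. Math. Extra Vol. Coates (2006), Prop. 3.2 (p. 358). [Greenberg2006]
* J. S. Milne, *Arithmetic Duality Theorems*, 2nd ed. (2006), I Thm. 5.1 (p. 67). [MilneADT2006]
* (the references of the re-typed file apply verbatim)
-/

set_option autoImplicit false

noncomputable section

open scoped Classical
open NumberField IsDedekindDomain Field
open Literature.NumberTheory.GaloisRepresentations Literature.NumberTheory.GaloisCohomology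
open Literature.NumberTheory.EllipticCurves (ZpExtension BigRepModule bigRep)
open Literature.NumberTheory.IwasawaTheory Literature.NumberTheory.IwasawaTheory.Greenberg2016
  Literature.NumberTheory.IwasawaTheory.Greenberg2006
open Summit.BirchSwinnertonDyer.BirchSwinnertonDyer.Theorems.WeakLeopoldtDescent
  Summit.BirchSwinnertonDyer.BirchSwinnertonDyer.Theorems.AcTwistDeformationShapiroH

namespace Summit.BirchSwinnertonDyer.BirchSwinnertonDyer.Theorems.WeakLeopoldtAbove

section Generic

variable {K : Type} [Field K] [NumberField K] (S : Set (HeightOneSpectrum (𝓞 K))) {p : ℕ} [Fact p.Prime]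
  (hS : ∀ v : HeightOneSpectrum (𝓞 K), ((p : ℕ) : 𝓞 K) ∈ v.asIdeal → v ∈ S)
  (κ : ZpExtension K p)
  {𝒪 : Type} [CommRing 𝒪] [IsDomain 𝒪] [TopologicalSpace 𝒪] [TopologicalSpace (PowerSeries 𝒪)]
  {A : Type} [AddCommGroup A] [Module 𝒪 A] [TopologicalSpace A] [DiscreteTopology A] [ContinuousSMul 𝒪 A]
  [ContinuousSMul (PowerSeries 𝒪) (BigRepModule 𝒪 p A)]
  (ρ₀ : ContinuousRep (GaloisGroupUnramifiedOutside K S) 𝒪 A)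

end Generic

section Facts

variable {K : Type} [Field K] [NumberField K] (S : Set (HeightOneSpectrum (𝓞 K))) {p : ℕ} [Fact p.Prime]
  (hS : ∀ v : HeightOneSpectrum (𝓞 K), ((p : ℕ) : 𝓞 K) ∈ v.asIdeal → v ∈ S)
  (κ : ZpExtension K p)
  [TopologicalSpace (PowerSeries ℤ_[p])] [IsTopologicalRing (PowerSeries ℤ_[p])]
  {A : Type} [AddCommGroup A] [Module ℤ_[p] A] [TopologicalSpace A] [DiscreteTopology A] [ContinuousSMul ℤ_[p] A]
  [ContinuousSMul (PowerSeries ℤ_[p]) (BigRepModule ℤ_[p] p A)]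
  (ρ₀ : ContinuousRep (GaloisGroupUnramifiedOutside K S) ℤ_[p] A)

omit [ContinuousSMul ℤ_[p] A] in
/-- **[T28b `OfTateTC` re-typing: Greenberg 2006 Prop. 3.2 by name ↦ Milne ADT I Thm. 5.1 by name AT TOTALLY COMPLEX FIELDS (Prop. 3.2 is read in degrees ≤ 2 and at totally complex fields only, `prop32_global_le_two_of_tate_tc`).]** [cite: MilneADT2006, I Thm. 5.1 (p. 67)] `H^i(K_Σ/K, 𝐃₁)` is cofinitely generated over `Λ = ℤ_p⟦T⟧` for a cofree `𝐃₁`, IN DEGREES `i ≤ 2`, read off Greenberg 2006 Prop. 3.2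
(PUB fact `(∀ (L : Type) [Field L] [NumberField L] [IsTotallyComplex L], Literature.NumberTheory.GaloisCohomology.tateGlobalEulerPoincareCharacteristic L)`, global clause). [cite: Greenberg2006, Prop. 3.2 (p. 358)] -/
theorem isCofinitelyGenerated_H_bigRep_of_fact_ofTateTC (h32 : (∀ (L : Type) [Field L] [NumberField L] [IsTotallyComplex L], Literature.NumberTheory.GaloisCohomology.tateGlobalEulerPoincareCharacteristic L))
    [IsTotallyComplex K] (hSf : S.Finite)
    (hcf : IsCofree (PowerSeries ℤ_[p]) (BigRepModule ℤ_[p] p A)) (i : ℕ) (hi : i ≤ 2 := by omega) :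
    IsCofinitelyGenerated (PowerSeries ℤ_[p]) ((bigRep (κ.liftUnramifiedOutside S hS) ρ₀).H i) :=
  prop32_global_le_two_of_tate_tc h32 hSf hS
    (AcTwistDeformation.nonempty_iwasawaAlgebra_ringEquiv_mvPowerSeries p) (bigRep (κ.liftUnramifiedOutside S hS) ρ₀)
    exists_zpow_smul_eq_zero_bigRepModule (IsCofree.isCofinitelyGenerated hcf) i hi

omit [ContinuousSMul ℤ_[p] A] in
/-- **[T28b `OfTateTC` re-typing: Greenberg 2006 Prop. 3.2 by name ↦ Milne ADT I Thm. 5.1 by name AT TOTALLY COMPLEX FIELDS (Prop. 3.2 is read in degrees ≤ 2 and at totally complex fields only, `prop32_global_le_two_of_tate_tc`).]** [cite: MilneADT2006, I Thm. 5.1 (p. 67)] **`H²(K_Σ/K, 𝐃₁) = 0` from `corank_Λ H²(K_Σ/K, 𝐃₁) = 0`, MODULO the two PUB facts** (`cd_p(G_{K,Σ}) ≤ 2`, Prop. 3.2):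
`p ≠ 2`, `S ⊇ {v ∣ p}` finite, `𝐃₁ = bigRep κ̄ ρ₀` cofree over `ℤ_p⟦T⟧`. This is "LEO-grade vanishing" on the
anticyclotomic line, where `H²` need not vanish a priori (LEAD verdict v3.1 §3 (iii)); the corank input is LEAD g2's
squeeze. [cite: Greenberg2006, §3 A pp. 358–360, §4 A Prop. 4.1] [cite: Greenberg2016Selmer, §2.2–2.3 pp. 6–7]
[cite: NeukirchSchmidtWingberg2008, (8.3.18)] -/
theorem subsingleton_H_two_bigRep_of_facts_ofTateTC (hCD2 : groupCdLE_two_galoisGroupUnramifiedOutside K)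
    (h32 : (∀ (L : Type) [Field L] [NumberField L] [IsTotallyComplex L], Literature.NumberTheory.GaloisCohomology.tateGlobalEulerPoincareCharacteristic L))
    [IsTotallyComplex K] (hp2 : p ≠ 2) (hSf : S.Finite)
    (hcf : IsCofree (PowerSeries ℤ_[p]) (BigRepModule ℤ_[p] p A))
    (h0 : HasCorank (PowerSeries ℤ_[p]) ((bigRep (κ.liftUnramifiedOutside S hS) ρ₀).H 2) 0) :
    Subsingleton ((bigRep (κ.liftUnramifiedOutside S hS) ρ₀).H 2) :=
  subsingleton_H_bigRep_of_hasCorank_zero S hS κ ρ₀ (groupCdLE_two_of_fact S hS hCD2 hp2) hcf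
    (isCofinitelyGenerated_H_bigRep_of_fact_ofTateTC S hS κ ρ₀ h32 hSf hcf 2) h0

/-- **[T28b `OfTateTC` re-typing: Greenberg 2006 Prop. 3.2 by name ↦ Milne ADT I Thm. 5.1 by name AT TOTALLY COMPLEX FIELDS (Prop. 3.2 is read in degrees ≤ 2 and at totally complex fields only, `prop32_global_le_two_of_tate_tc`).]** [cite: MilneADT2006, I Thm. 5.1 (p. 67)] **WL above `K_∞` MODULO the two PUB facts: `H²(Gal(K_Σ/K_∞), A) = 0`** — `p ≠ 2`, `S ⊇ {v ∣ p}` finite, `A`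
`p`-primary, `𝐃₁ = bigRep κ̄ ρ₀` cofree over `ℤ_p⟦T⟧` with `corank H²(K_Σ/K, 𝐃₁) = 0`. THE V21 INPUT WL_A in the
`galoisGroupAbove` currency. [cite: Greenberg2006, Thm. 3 p. 342; §3 A pp. 358–360; §4 A Prop. 4.1]
[cite: Greenberg2016Selmer, §2.2–2.3 pp. 6–7] [cite: NeukirchSchmidtWingberg2008, (8.3.18)] -/
theorem subsingleton_H_two_above_of_facts_ofTateTC (hCD2 : groupCdLE_two_galoisGroupUnramifiedOutside K)
    (h32 : (∀ (L : Type) [Field L] [NumberField L] [IsTotallyComplex L], Literature.NumberTheory.GaloisCohomology.tateGlobalEulerPoincareCharacteristic L))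
    [IsTotallyComplex K] (hp2 : p ≠ 2) (hSf : S.Finite)
    (hA : ∀ a : A, ∃ m : ℕ, (p ^ m : ℤ) • a = 0)
    (hcf : IsCofree (PowerSeries ℤ_[p]) (BigRepModule ℤ_[p] p A))
    (h0 : HasCorank (PowerSeries ℤ_[p]) ((bigRep (κ.liftUnramifiedOutside S hS) ρ₀).H 2) 0) :
    Subsingleton ((ρ₀.restrict (galoisGroupAboveSubtype S κ.kerSubgroup)).H 2) :=
  subsingleton_H_above_of_subsingleton_H_bigRep S hS κ ρ₀ hA 2
    (subsingleton_H_two_bigRep_of_facts_ofTateTC S hS κ ρ₀ hCD2 h32 hp2 hSf hcf h0)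

/-- **[T28b `OfTateTC` re-typing: Greenberg 2006 Prop. 3.2 by name ↦ Milne ADT I Thm. 5.1 by name AT TOTALLY COMPLEX FIELDS (Prop. 3.2 is read in degrees ≤ 2 and at totally complex fields only, `prop32_global_le_two_of_tate_tc`).]** [cite: MilneADT2006, I Thm. 5.1 (p. 67)] **WL above `K_∞` for a CHARACTER-type coefficient module** (`A` `p`-primary of Pontryagin corank ONE:
`ℤ_p ≅ Hom(A, ℚ/ℤ)` through `jQ`, e.g. `A = ℚ_p/ℤ_p(θ) ≅ (F/𝒪)(θ)`), MODULO the two PUB facts and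
`corank H²(K_Σ/K, 𝐃₁) = 0` (LEAD g2 `hasCorank_H1_one_and_H2_zero`): cofreeness of `𝐃₁` is LEAD g2's
`AcTwistDeformation.isCofree_bigRepModule`. For `θ ∈ {θsub, θquot}` of the residual pair this is WL_ω / WL_1 of the V21
road. [cite: Greenberg2006, Thm. 3 p. 342, §4 A Prop. 4.1] [cite: Greenberg2016Selmer, §2.3 p. 7 L7–17]
[cite: PollackWeston2011, proof of Prop. A.2] -/
theorem subsingleton_H_two_above_of_corank_one_ofTateTC (hCD2 : groupCdLE_two_galoisGroupUnramifiedOutside K)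
    (h32 : (∀ (L : Type) [Field L] [NumberField L] [IsTotallyComplex L], Literature.NumberTheory.GaloisCohomology.tateGlobalEulerPoincareCharacteristic L))
    [IsTotallyComplex K] (hp2 : p ≠ 2) (hSf : S.Finite)
    (hA : ∀ a : A, ∃ k : ℕ, p ^ k • a = 0) (jQ : A →+ AddCircle (1 : ℚ))
    (hinj : ∀ c : ℤ_[p], (∀ a : A, jQ (c • a) = 0) → c = 0)
    (hsurj : ∀ φ : A →+ AddCircle (1 : ℚ), ∃ c : ℤ_[p], ∀ a : A, φ a = jQ (c • a))
    (h0 : HasCorank (PowerSeries ℤ_[p]) ((bigRep (κ.liftUnramifiedOutside S hS) ρ₀).H 2) 0) :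
    Subsingleton ((ρ₀.restrict (galoisGroupAboveSubtype S κ.kerSubgroup)).H 2) :=
  subsingleton_H_two_above_of_facts_ofTateTC S hS κ ρ₀ hCD2 h32 hp2 hSf (fun a ↦ exists_zpow_smul_eq_zero_of_nat (hA a))
    (AcTwistDeformation.isCofree_bigRepModule hA jQ hinj hsurj) h0

/-- **[T28b `OfTateTC` re-typing: Greenberg 2006 Prop. 3.2 by name ↦ Milne ADT I Thm. 5.1 by name AT TOTALLY COMPLEX FIELDS (Prop. 3.2 is read in degrees ≤ 2 and at totally complex fields only, `prop32_global_le_two_of_tate_tc`).]** [cite: MilneADT2006, I Thm. 5.1 (p. 67)] **WL above `K_∞` for `A ≃ₗ[ℤ_p] (ℚ_p/ℤ_p)ⁿ`** (e.g. `A = E[p^∞]`, `n = 2`, through a basis of `T_pE`), MODULO the two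
PUB facts and `corank H²(K_Σ/K, 𝐃₁) = 0` (w3 g3's rank-`n` squeeze): cofreeness of `𝐃₁` is w3 g3's
`AcTwistDeformation.isCofree_bigRepModule_pi` on the dual basis `exists_pi_character_hinj_hsurj_of_linearEquiv`. This is
WL_f of the V21 road. [cite: Greenberg2006, Thm. 3 p. 342, §4 A Prop. 4.1] [cite: Greenberg2016Selmer, §2.3 p. 7 L7–17] -/
theorem subsingleton_H_two_above_of_linearEquiv_pi_ofTateTC {n : ℕ} (hCD2 : groupCdLE_two_galoisGroupUnramifiedOutside K)
    (h32 : (∀ (L : Type) [Field L] [NumberField L] [IsTotallyComplex L], Literature.NumberTheory.GaloisCohomology.tateGlobalEulerPoincareCharacteristic L))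
    [IsTotallyComplex K] (hp2 : p ≠ 2) (hSf : S.Finite)
    (e : A ≃ₗ[ℤ_[p]] (Fin n → QpModZp p))
    (h0 : HasCorank (PowerSeries ℤ_[p]) ((bigRep (κ.liftUnramifiedOutside S hS) ρ₀).H 2) 0) :
    Subsingleton ((ρ₀.restrict (galoisGroupAboveSubtype S κ.kerSubgroup)).H 2) := by
  obtain ⟨hA, jQ, hinj, hsurj⟩ := AcTwistDeformation.exists_pi_character_hinj_hsurj_of_linearEquiv e
  exact subsingleton_H_two_above_of_facts_ofTateTC S hS κ ρ₀ hCD2 h32 hp2 hSf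
    (fun a ↦ exists_zpow_smul_eq_zero_of_nat (hA a)) (AcTwistDeformation.isCofree_bigRepModule_pi hA jQ hinj hsurj) h0

end Facts

section Bridge

variable {G H : Type} [Group G] [TopologicalSpace G] [Group H] [TopologicalSpace H] [IsTopologicalGroup H]
  {R₁ : Type} [CommRing R₁] [TopologicalSpace R₁] {R₂ : Type} [CommRing R₂] [TopologicalSpace R₂]
  {M₁ : Type} [AddCommGroup M₁] [Module R₁ M₁] [TopologicalSpace M₁] [IsTopologicalAddGroup M₁] [ContinuousSMul R₁ M₁]
  {M₂ : Type} [AddCommGroup M₂] [Module R₂ M₂] [TopologicalSpace M₂] [IsTopologicalAddGroup M₂] [ContinuousSMul R₂ M₂]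

end Bridge

end Summit.BirchSwinnertonDyer.BirchSwinnertonDyer.Theorems.WeakLeopoldtAbove

end
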